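import Summits.ResolutionOfSingularities.ResolutionOfSingularities.Theorems.HilbertSamuelEliminationSigmaMaxModificationsCorridor3ConfinedAssemblyMax
import Summits.ResolutionOfSingularities.ResolutionOfSingularities.Theorems.HilbertSamuelEliminationSigmaMaxModificationsCorridor3TameSmallPrimes
import HarnessLib

/-!
# Route `HilbertSamuelElimination`, crux `SigmaMaxModificationsCorridor3`
# (stmt-ResolutionOfSingularities-19249; child of `SigmaMaxModifications` stmt-…-18506),
# line `tame_wild` v3 (confined form) — the REGISTERED stub `stub_confinedTameNu3_of_thor4`,
# verbatim, from the typed bricks T0–T4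

[OURS · L1 W4.2] The registered signature of `stub_confinedTameNu3_of_thor4` (skeleton tame_wild v3,
Cruxes/SigmaMaxModificationsCorridor3, registered on stmt-…-19249 by the lead, 2026-08-26), derived
from the five typed bricks of helpers-v3 (T0 bridge, T1 per-chart transfer, T2 hypersurface chart,
T3 embedded tower, T4 chart dictionary) taken as hypotheses: unfold the tame value to
`ν = hypersurfaceHF m` with `2 ≤ m < p` (landed `two_le_of_isTameValue_of_mem_hsValues`, p459657) and
apply the landed assembly `confinedNu3_of_bricks_max` (T4 in its maximal form; supersedes
`confinedTameNu3_of_thor4_of_bricks` / p480768, whose T4 hypothesis carried a false absent-value branch). When T0–T4 land as theorems, the stub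
closes by this file with the five hypotheses discharged. NOT a statement of any manuscript.

## Sources

* V. Cossart, U. Jannsen, S. Saito, LNM 2270 (2020), Def. 6.14, Rem. 6.24, Lemma 2.23.
  [CossartJannsenSaito2020]
* E. Bierstone, D. Grigoriev, P. Milman, J. Włodarczyk, arXiv:1206.3090, Def. 3.1.3, Thm. 8.0.5.
  [BierstoneGrigorievMilmanWlodarczyk2011]
-/

set_option linter.dupNamespace false -- mandated namespace of this single-conjunct summit

noncomputable section

open CategoryTheory AlgebraicGeometry TopologicalSpace Topology
open Literature.AlgebraicGeometry.Resolution Literature.RingTheory.HilbertSamuel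

namespace Summit.ResolutionOfSingularities.ResolutionOfSingularities.Theorems.SigmaMaxModificationsCorridor3.TameWild

/-- **The registered stub `stub_confinedTameNu3_of_thor4`, verbatim, modulo the bricks T0–T4**
(hypotheses `hT0 … hT4` = the typed signatures of helpers-v3). [cite: CossartJannsenSaito2020, Def. 6.14, Rem. 6.24]
[cite: BierstoneGrigorievMilmanWlodarczyk2011, Thm. 8.0.5] -/
theorem confinedTameNu3_of_thor4_of_bricks_max
    -- T0: bridge
    (hT0 : ∀ {X : Scheme.{0}} (M : MarkedIdeal X) {X' : Scheme.{0}} (Φ : X' ⟶ X)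
      (M' : MarkedIdeal X'), IsMarkedResolution M Φ M' → ∃ s : CentreSeq X, s.IsResolutionOf M)
    -- T1: per-chart transfer
    (hT1 : ∀ (k : Type) [Field k] (Y : Scheme.{0}) (g : Y ⟶ Spec (.of k))
      [LocallyOfFiniteType g] [IsReduced Y], topologicalKrullDim Y ≤ ((3 : ℕ) : WithBot ℕ∞) →
      ∀ (ν : ℕ → ℕ), Maximal (· ∈ Scheme.hsValues Y 3) ν → ∀ (m : ℕ), 1 ≤ m →
      ∀ (V : Scheme.{0}) (j : V ⟶ Y) [IsOpenImmersion j] (Z : Scheme.{0}), Scheme.IsRegular Z →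
      ∀ (I : Z.IdealSheafData), IsEffectiveCartier I → ∀ (ι : V ⟶ Z) [IsClosedImmersion ι],
      ι.ker = I →
      (⟨I, [], m⟩ : MarkedIdeal Z).support = ι.base '' Scheme.hsStratum V 3 ν →
      (∀ z : Z, idealOrder I z ≤ (m : ℕ∞)) →
      ∀ (t : CentreSeq Z), t.IsResolutionOf (⟨I, [], m⟩ : MarkedIdeal Z) →
      ∃ s : CentreSeq V, s.AllRegular ∧ s.CentresOver (Scheme.hsStratum V 3 ν) ∧
        (∀ x' : s.top, Scheme.hsFun s.top 3 x' ≤ Scheme.hsFun V 3 (s.comp.base x')) ∧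
        ν ∉ Scheme.hsValues s.top 3)
    -- T2: hypersurface chart at a closed stratum point
    (hT2 : ∀ (p : ℕ), p.Prime → ∀ (k : Type) [Field k] [CharP k p] [PerfectField k]
      (Y : Scheme.{0}) (g : Y ⟶ Spec (.of k)) [LocallyOfFiniteType g] [IsReduced Y],
      topologicalKrullDim Y ≤ ((3 : ℕ) : WithBot ℕ∞) → ∀ (ν : ℕ → ℕ),
      Maximal (· ∈ Scheme.hsValues Y 3) ν → ∀ (m : ℕ), 2 ≤ m → ν = hypersurfaceHF m →
      ∀ (y : Y), y ∈ Scheme.hsStratum Y 3 ν → IsClosed ({y} : Set Y) →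
      ∀ (A : Set Y), A.Finite → (∀ a ∈ A, IsClosed ({a} : Set Y)) → y ∉ A →
      ∃ (U : Y.Opens) (_ : y ∈ U) (Z : Scheme.{0}) (h : Z ⟶ Spec (.of k)) (I : Z.IdealSheafData)
        (ι : (U : Scheme.{0}) ⟶ Z),
        Disjoint (U : Set Y) A ∧ IsSeparated h ∧ LocallyOfFiniteType h ∧ QuasiCompact h ∧
        IsIntegral Z ∧ Scheme.IsRegular Z ∧ IsAffine Z ∧
        topologicalKrullDim Z ≤ ((4 : ℕ) : WithBot ℕ∞) ∧ I ≠ ⊥ ∧ IsEffectiveCartier I ∧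
        IsClosedImmersion ι ∧ ι ≫ h = U.ι ≫ g ∧ ι.ker = I ∧
        (⟨I, [], m⟩ : MarkedIdeal Z).support = ι.base '' Scheme.hsStratum (U : Scheme.{0}) 3 ν ∧
        ∀ z : Z, idealOrder I z ≤ (m : ℕ∞))
    -- T3: embedded tower
    (hT3 : ∀ (k : Type) [Field k] (U Z : Scheme.{0}) (h : Z ⟶ Spec (.of k))
      [IsSeparated h] [LocallyOfFiniteType h] [QuasiCompact h], IsIntegral Z →
      Scheme.IsRegular Z → topologicalKrullDim Z ≤ ((4 : ℕ) : WithBot ℕ∞) →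
      ∀ (I : Z.IdealSheafData), I ≠ ⊥ → IsEffectiveCartier I → ∀ (ι : U ⟶ Z)
      [IsClosedImmersion ι], ι.ker = I → ∀ (r : CentreSeq U), r.AllRegular →
      ∃ (Z' : Scheme.{0}) (h' : Z' ⟶ Spec (.of k)) (I' : Z'.IdealSheafData) (ι' : r.top ⟶ Z'),
        IsSeparated h' ∧ LocallyOfFiniteType h' ∧ QuasiCompact h' ∧ IsIntegral Z' ∧
        Scheme.IsRegular Z' ∧ topologicalKrullDim Z' ≤ ((4 : ℕ) : WithBot ℕ∞) ∧ I' ≠ ⊥ ∧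
        IsEffectiveCartier I' ∧ IsClosedImmersion ι' ∧ ι' ≫ h' = r.comp ≫ ι ≫ h ∧
        ι'.ker = I')
    -- T4: chart dictionary
    (hT4 : ∀ (k : Type) [Field k] (Y : Scheme.{0}) (g : Y ⟶ Spec (.of k))
      [LocallyOfFiniteType g] [IsReduced Y], topologicalKrullDim Y ≤ ((3 : ℕ) : WithBot ℕ∞) →
      ∀ (ν : ℕ → ℕ) (m : ℕ), 1 ≤ m → ν = hypersurfaceHF m →
      Maximal (· ∈ Scheme.hsValues Y 3) ν →
      ∀ (V : Scheme.{0}) (j : V ⟶ Y) [IsOpenImmersion j] (Z : Scheme.{0}), Scheme.IsRegular Z →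
      topologicalKrullDim Z ≤ ((4 : ℕ) : WithBot ℕ∞) → ∀ (I : Z.IdealSheafData), I ≠ ⊥ →
      IsEffectiveCartier I → ∀ (ι : V ⟶ Z) [IsClosedImmersion ι], ι.ker = I →
      (⟨I, [], m⟩ : MarkedIdeal Z).support = ι.base '' Scheme.hsStratum V 3 ν ∧
        ∀ z : Z, idealOrder I z ≤ (m : ℕ∞)) :
    -- the registered signature of `stub_confinedTameNu3_of_thor4`, verbatim
    ∀ p : ℕ, p.Prime → 5 ≤ p →
      (∀ (k : Type) [Field k] [CharP k p] [PerfectField k] (Z : Scheme.{0})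
        (h : Z ⟶ Spec (.of k)), IsSeparated h → LocallyOfFiniteType h → QuasiCompact h →
        IsIntegral Z → Scheme.IsRegular Z → topologicalKrullDim Z ≤ ((4 : ℕ) : WithBot ℕ∞) →
        ∀ (I : Z.IdealSheafData), I ≠ ⊥ → IsEffectiveCartier I → ∀ m : ℕ, 1 ≤ m → m < p →
          ∃ (Z' : Scheme.{0}) (Φ : Z' ⟶ Z) (M' : MarkedIdeal Z'),
            IsMarkedResolution (⟨I, [], m⟩ : MarkedIdeal Z) Φ M') →
      ∀ (k : Type) [Field k] [CharP k p] [PerfectField k] (Y : Scheme.{0})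
        (g : Y ⟶ Spec (.of k)), IsSeparated g → LocallyOfFiniteType g → QuasiCompact g →
        IsReduced Y → ((3 : ℕ) : WithBot ℕ∞) ≤ topologicalKrullDim Y →
        topologicalKrullDim Y ≤ ((3 : ℕ) : WithBot ℕ∞) →
        ∀ ν : ℕ → ℕ, Maximal (· ∈ Scheme.hsValues Y 3) ν → ν ≠ iterPSum 3 Phi →
          IsTameValue p ν →
          ¬ Disjoint (closure ((Scheme.regularLocus Y)ᶜ \ Scheme.hsStratum Y 3 ν))
              (Scheme.hsStratum Y 3 ν) →
          ∀ s : CentreSeq Y, s.AllRegular → s.CentresOver (Scheme.hsStratum Y 3 ν) →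
            (∀ x' : s.top, Scheme.hsFun s.top 3 x' ≤ Scheme.hsFun Y 3 (s.comp.base x')) →
            ((fun x' => s.comp.base x') '' Scheme.hsStratum s.top 3 ν).Finite →
            (∀ y ∈ (fun x' => s.comp.base x') '' Scheme.hsStratum s.top 3 ν,
              IsClosed ({y} : Set Y)) →
            NuMod Y 3 3 ν := by
  intro p hp _ hthor k _ _ _ Y g _ hft hqc hred _ hd3 ν hν hνΦ ht _ s hreg hover hmono hfin hclosed
  haveI := hft
  haveI := hqc
  haveI := hred
  haveI : IsLocallyNoetherian Y := LocallyOfFiniteType.isLocallyNoetherian g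
  obtain ⟨m, hm2, hmp, hνm⟩ := two_le_of_isTameValue_of_mem_hsValues hν.1 hνΦ ht
  exact confinedNu3_of_bricks_max p hT0 hT1 hT2 hT3 hT4 hthor hp k Y g hd3 ν hν m hm2 hmp hνm s hreg hover
    hmono hfin hclosed

end Summit.ResolutionOfSingularities.ResolutionOfSingularities.Theorems.SigmaMaxModificationsCorridor3.TameWild

end
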